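import Mathlib
import HarnessLib
import Literature.Analysis.FluidPDE.SelfSimilar
import Literature.Analysis.FluidPDE.LocalTypeI
import Literature.Analysis.FluidPDE.VectorCalculus
import Literature.Analysis.FluidPDE.OseenZoomCovariance
import Literature.Analysis.FluidPDE.NSBoundedMildOseenDuhamel
import Literature.Analysis.UnboundedOperators.HeatKernel
import Literature.Analysis.UnboundedOperators.HeatKernelHeatEquation
import Summits.NavierStokesRegularity.NavierStokesRegularity.Theorems.LocalSineTubeDoorProfileAlignedWindowRigidityAncient
import Summits.NavierStokesRegularity.NavierStokesRegularity.Theorems.PoloidalWindowDoorPoloidalWindowRigidityAxisymmetric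

/-!
# Route `PoloidalWindowDoor`, crux `PoloidalWindowRigidity` (K2, stmt-NavierStokesRegularity-19708) —
# ZOOM-OUT TOOLS for the Type-I class: recentred zooms, backward ε-regularity, tail-to-slab propagation

Cell ns-regularity-ideate, seat ns-poloidal-K2-p2 (stub-worker; lands `--supports` the crux, `--as helper`).  Engine
of the mechanism «zoom-out symmetry gain» (companion file `…PoloidalWindowRigidityPeriodic`), valid for the WHOLE
route class `𝔓(C)` (Type-I rate `‖v(t)‖ ≤ C/√(−t)`, continuous on the open slab, unit-viscosity Oseen-mild between
negative times, divergence-free slices — no poloidality):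

* `class_zoom` — the class is invariant under the recentred parabolic zooms `(𝒵v)(s,y) = c v(c²s, x₀ + c y)`
  (`c > 0`; `…Axisymmetric.class_translate` + the tree's `oseen_zoom`; `divergence_zoom` for the slices);
* `exists_eps_eq_zero_tail` — BACKWARD ε-REGULARITY: there is an absolute `ε₀ > 0` such that an Oseen-mild field with
  `√(−t)‖v(t,x)‖ ≤ ε₀` on a tail `t < T ≤ 0` vanishes on that tail (the mild identity from `4t` to `t` and the
  tree bounds `norm_heatExtension_le`, `exists_norm_oseenDuhamel_bounded_le` give `B ≤ B/2 + K₀B²` for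
  `B = sup_{t<T} √(−t)‖v(t)‖_∞`; cf. Chae–Wolf 2017 §3 Step 1 / tree `exists_eps_typeI_small_eq_zero`, which needs
  the space–time Type-I envelope only to produce mildness — here mildness is the hypothesis);
* `eq_zero_of_eq_zero_tail` — vanishing on a backward tail propagates to the whole slab (joint real-analyticity,
  tree `analyticOnNhd_uncurry`, + the identity theorem on the convex slab);
* `eq_zero_of_tendsto_zero` — hence a profile of the class whose scale-invariant size `sup_x √(−t)‖v(t,x)‖` tends
  to `0` as `t → −∞` is trivial.  (Any structure of a profile that turns into a continuous symmetry under
  recentred zoom-OUT therefore kills it: `…Periodic`.)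

WHAT THIS IS NOT: not a claim about Navier–Stokes regularity — class-level tools for settled strata of a door
route's crux (bears_on LADDER-NS N0, rung N0-LocalTubeDoorPoloidal).
-/

noncomputable section

-- the summit and its single sub-problem share the name (CONVENTIONS §1), as in every Theorems file
set_option linter.dupNamespace false

namespace Summit.NavierStokesRegularity.NavierStokesRegularity.Theorems.PoloidalWindowDoorPoloidalWindowRigidityZoomOut

open MeasureTheory Set Function Filter Topology TopologicalSpace Metric
open scoped RealInnerProductSpace InnerProductSpace
open Literature.Analysis Literature.Analysis.FluidPDE
open Summit.NavierStokesRegularity.NavierStokesRegularity.Theorems.LocalSineTubeDoorProfileAlignedWindowRigidityAncient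
open Summit.NavierStokesRegularity.NavierStokesRegularity.Theorems.PoloidalWindowDoorPoloidalWindowRigidityAxisymmetric

variable {C : ℝ} {v : ℝ → EuclideanSpace ℝ (Fin 3) → EuclideanSpace ℝ (Fin 3)}

/-! ### 1. the class is invariant under recentred parabolic zooms -/

/-- The divergence of a zoomed slice: `div (y ↦ c V(c y)) (y) = c² div V (c y)` for `V` differentiable. -/
theorem divergence_zoom {V : EuclideanSpace ℝ (Fin 3) → EuclideanSpace ℝ (Fin 3)} (hV : Differentiable ℝ V)
    (c : ℝ) (y : EuclideanSpace ℝ (Fin 3)) :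
    VectorCalculus.divergence (fun z => c • V (c • z)) y = c ^ 2 * VectorCalculus.divergence V (c • y) := by
  have haff : HasFDerivAt (fun z : EuclideanSpace ℝ (Fin 3) => c • z)
      (c • ContinuousLinearMap.id ℝ (EuclideanSpace ℝ (Fin 3))) y :=
    (ContinuousLinearMap.id ℝ (EuclideanSpace ℝ (Fin 3))).hasFDerivAt.const_smul c
  have h1 : HasFDerivAt (fun z => V (c • z))
      ((fderiv ℝ V (c • y)).comp (c • ContinuousLinearMap.id ℝ (EuclideanSpace ℝ (Fin 3)))) y :=
    (hV (c • y)).hasFDerivAt.comp y haff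
  have h2 : HasFDerivAt (fun z => c • V (c • z))
      (c • (fderiv ℝ V (c • y)).comp (c • ContinuousLinearMap.id ℝ (EuclideanSpace ℝ (Fin 3)))) y :=
    h1.const_smul c
  rw [VectorCalculus.divergence, VectorCalculus.divergence, h2.fderiv, ContinuousLinearMap.comp_smul,
    ContinuousLinearMap.comp_id, smul_smul, ContinuousLinearMap.toLinearMap_smul, LinearMap.map_smul, smul_eq_mul, sq]

/-- **The class is invariant under the recentred parabolic zooms** `(𝒵v)(s, y) = c v(c² s, x₀ + c y)` (`c > 0`,
`x₀ ∈ ℝ³`): Type-I rate with the SAME constant, continuity on the open slab, the Oseen identity (tree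
`oseen_zoom`) and divergence-free slices. -/
theorem class_zoom (hrate : HasTypeITimeDecay C v)
    (hcont : ContinuousOn (uncurry v) (Iio (0 : ℝ) ×ˢ univ))
    (hmild : ∀ s t : ℝ, s < t → t < 0 → ∀ x,
      v t x = UnboundedOperators.heatExtension (v s) (t - s) x - oseenDuhamel 1 s v v t x)
    (hdiv : ∀ t < 0, VectorCalculus.IsDivFree (v t)) {c : ℝ} (hc : 0 < c) (x₀ : EuclideanSpace ℝ (Fin 3)) :
    HasTypeITimeDecay C (fun s y => c • v (c ^ 2 * s) (x₀ + c • y)) ∧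
    ContinuousOn (uncurry fun s y => c • v (c ^ 2 * s) (x₀ + c • y)) (Iio (0 : ℝ) ×ˢ univ) ∧
    (∀ s t : ℝ, s < t → t < 0 → ∀ x, (fun s y => c • v (c ^ 2 * s) (x₀ + c • y)) t x =
      UnboundedOperators.heatExtension ((fun s y => c • v (c ^ 2 * s) (x₀ + c • y)) s) (t - s) x -
        oseenDuhamel 1 s (fun s y => c • v (c ^ 2 * s) (x₀ + c • y))
          (fun s y => c • v (c ^ 2 * s) (x₀ + c • y)) t x) ∧
    (∀ t < 0, VectorCalculus.IsDivFree ((fun s y => c • v (c ^ 2 * s) (x₀ + c • y)) t)) := by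
  -- translate first: `u(t, y) = v(t, y + x₀)`
  obtain ⟨hrate₁, hcont₁, hmild₁, hdiv₁⟩ := class_translate x₀ hrate hcont hmild hdiv
  set u : ℝ → EuclideanSpace ℝ (Fin 3) → EuclideanSpace ℝ (Fin 3) := fun t y => v t (y + x₀) with hu
  have hwu : (fun s y => c • v (c ^ 2 * s) (x₀ + c • y)) = fun s y => c • u (c ^ 2 * s) (c • y) := by
    funext s y
    simp only [hu, add_comm x₀]
  rw [hwu]
  have hc2 : 0 < c ^ 2 := by positivity
  have hneg : ∀ {s : ℝ}, s < 0 → c ^ 2 * s < 0 := fun hs => mul_neg_of_pos_of_neg hc2 hs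
  refine ⟨?_, ?_, ?_, ?_⟩
  · -- the rate, same constant
    intro s hs y
    have h := hrate₁ (c ^ 2 * s) (hneg hs) (c • y)
    have hsq : Real.sqrt (-(c ^ 2 * s)) = c * Real.sqrt (-s) := by
      rw [show -(c ^ 2 * s) = c ^ 2 * (-s) by ring, Real.sqrt_mul (sq_nonneg c), Real.sqrt_sq hc.le]
    rw [hsq] at h
    have hs' : 0 < Real.sqrt (-s) := Real.sqrt_pos.2 (neg_pos.2 hs)
    calc ‖c • u (c ^ 2 * s) (c • y)‖ = c * ‖u (c ^ 2 * s) (c • y)‖ := by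
          rw [norm_smul, Real.norm_of_nonneg hc.le]
      _ ≤ c * (C / (c * Real.sqrt (-s))) := mul_le_mul_of_nonneg_left h hc.le
      _ = C / Real.sqrt (-s) := by field_simp
  · -- continuity on the open slab
    have hφ : Continuous fun z : ℝ × EuclideanSpace ℝ (Fin 3) => (c ^ 2 * z.1, c • z.2) :=
      (continuous_const.mul continuous_fst).prodMk (continuous_snd.const_smul c)
    have hmaps : MapsTo (fun z : ℝ × EuclideanSpace ℝ (Fin 3) => (c ^ 2 * z.1, c • z.2))
        (Iio (0 : ℝ) ×ˢ univ) (Iio (0 : ℝ) ×ˢ univ) := fun z hz =>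
      mem_prod.2 ⟨hneg (mem_prod.1 hz).1, mem_univ _⟩
    exact ((hcont₁.comp hφ.continuousOn hmaps).const_smul c :)
  · -- the Oseen identity (tree `oseen_zoom` with the identity isometry)
    intro s t hst ht y
    have hf : ∀ X, u (c ^ 2 * t) X =
        UnboundedOperators.heatExtension (u (c ^ 2 * s)) (c ^ 2 * t - c ^ 2 * s) X -
          oseenDuhamel 1 (c ^ 2 * s) u u (c ^ 2 * t) X := fun X =>
      hmild₁ (c ^ 2 * s) (c ^ 2 * t) (mul_lt_mul_of_pos_left hst hc2) (hneg ht) X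
    have key := oseen_zoom hc (LinearIsometryEquiv.refl ℝ (EuclideanSpace ℝ (Fin 3))) hst hf y
    exact key
  · -- divergence-free slices
    intro t ht y
    have hbdd₁ := bdd_of_hasTypeITimeDecay hrate₁
    have hd : Differentiable ℝ (u (c ^ 2 * t)) :=
      ((analyticOnNhd_slice hcont₁ hbdd₁ hmild₁ (hneg ht)).contDiff (n := 1)).differentiable one_ne_zero
    change VectorCalculus.divergence (fun z => c • u (c ^ 2 * t) (c • z)) y = 0
    rw [divergence_zoom hd, hdiv₁ (c ^ 2 * t) (hneg ht) (c • y), mul_zero]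

/-! ### 3. backward ε-regularity: a small scale-invariant size on a tail forces `v ≡ 0` there -/

/-- **Backward ε-regularity for Oseen-mild fields with the Type-I rate.** There is an absolute `ε₀ > 0` such
that: if `v` satisfies the unit-viscosity Oseen identity between negative times and `√(−t)‖v(t, x)‖ ≤ ε₀` for all
`t < T` (`T ≤ 0`) and all `x`, then `v ≡ 0` on the tail `t < T`.  Proof (Chae–Wolf 2017 §3 Step 1, mild form): with
`B = sup_{t<T} √(−t)‖v(t)‖_∞ ≤ ε₀`, the identity `v(t) = e^{−3tΔ}v(4t) − B¹_{4t}(v,v)(t)` and the tree bounds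
`‖e^{σΔ}g‖_∞ ≤ ‖g‖_∞` (`norm_heatExtension_le`), `‖B¹ₛ(v,v)(t)‖ ≤ C_os M² 2√(t−s)`
(`exists_norm_oseenDuhamel_bounded_le`) give `B ≤ B/2 + K₀B²`, whence `B = 0`. -/
theorem exists_eps_eq_zero_tail :
    ∃ ε₀ : ℝ, 0 < ε₀ ∧ ∀ {v : ℝ → EuclideanSpace ℝ (Fin 3) → EuclideanSpace ℝ (Fin 3)} {T : ℝ}, T ≤ 0 →
      (∀ s t : ℝ, s < t → t < 0 → ∀ x,
        v t x = UnboundedOperators.heatExtension (v s) (t - s) x - oseenDuhamel 1 s v v t x) →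
      (∀ t < T, ∀ x, Real.sqrt (-t) * ‖v t x‖ ≤ ε₀) → ∀ t < T, ∀ x, v t x = 0 := by
  obtain ⟨Cos, hCos, hDuh⟩ := exists_norm_oseenDuhamel_bounded_le (E := EuclideanSpace ℝ (Fin 3))
  -- `K₀ = 2√3 C_os`, `ε₀ = 1/(8K₀ + 8)` so that `K₀ ε₀ ≤ 1/8`
  set K₀ : ℝ := 2 * Real.sqrt 3 * Cos with hK₀
  have hK₀0 : 0 ≤ K₀ := by positivity
  set ε₀ : ℝ := 1 / (8 * K₀ + 8) with hε₀
  have hε₀0 : 0 < ε₀ := by positivity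
  have hKε : K₀ * ε₀ ≤ 1 / 8 := by
    rw [hε₀, mul_one_div, div_le_iff₀ (by positivity)]
    linarith
  refine ⟨ε₀, hε₀0, ?_⟩
  intro v T hT hmild hsmall
  -- the scale-invariant supremum over the tail
  set S : Set ℝ := {r | ∃ t : ℝ, t < T ∧ ∃ x : EuclideanSpace ℝ (Fin 3), r = Real.sqrt (-t) * ‖v t x‖} with hS
  have hSb : BddAbove S := ⟨ε₀, by rintro r ⟨t, ht, x, rfl⟩; exact hsmall t ht x⟩
  have hSn : S.Nonempty := ⟨_, T - 1, by linarith, 0, rfl⟩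
  set B : ℝ := sSup S with hB
  have hqB : ∀ t < T, ∀ x, Real.sqrt (-t) * ‖v t x‖ ≤ B := fun t ht x => le_csSup hSb ⟨t, ht, x, rfl⟩
  have hBε : B ≤ ε₀ := csSup_le hSn (by rintro r ⟨t, ht, x, rfl⟩; exact hsmall t ht x)
  have hB0 : 0 ≤ B := le_trans (by positivity) (hqB (T - 1) (by linarith) 0)
  have hptw : ∀ σ < T, ∀ y, ‖v σ y‖ ≤ B / Real.sqrt (-σ) := by
    intro σ hσ y
    have hs : 0 < Real.sqrt (-σ) := Real.sqrt_pos.2 (by linarith)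
    rw [le_div_iff₀ hs, mul_comm]
    exact hqB σ hσ y
  -- the key estimate `√(−t)‖v(t,x)‖ ≤ B/2 + K₀B²`
  have hkey : ∀ t < T, ∀ x, Real.sqrt (-t) * ‖v t x‖ ≤ B / 2 + K₀ * B ^ 2 := by
    intro t ht x
    have ht0 : t < 0 := lt_of_lt_of_le ht hT
    set r : ℝ := Real.sqrt (-t) with hr
    have hr0 : 0 < r := Real.sqrt_pos.2 (by linarith)
    have hr2 : r ^ 2 = -t := Real.sq_sqrt (by linarith)
    have h4t : 4 * t < t := by linarith
    have h4T : 4 * t < T := by linarith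
    -- the mild identity from `4t` to `t`
    have hm := hmild (4 * t) t h4t ht0 x
    -- the caloric term: `‖e^{−3tΔ} v(4t)‖ ≤ B/√(−4t) = B/(2r)`
    have hsq4 : Real.sqrt (-(4 * t)) = 2 * r := by
      rw [show -(4 * t) = 2 ^ 2 * (-t) by ring, Real.sqrt_mul (by norm_num), Real.sqrt_sq (by norm_num)]
    have hheat : ‖UnboundedOperators.heatExtension (v (4 * t)) (t - 4 * t) x‖ ≤ B / (2 * r) := by
      have hb : ∀ z, ‖v (4 * t) z‖ ≤ B / (2 * r) := fun z => by
        have h := hptw (4 * t) h4T z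
        rwa [hsq4] at h
      exact UnboundedOperators.norm_heatExtension_le hb (by linarith) x
    -- the Duhamel term: on `(4t, t)` the field is bounded by `M = B/r`
    have hM0 : 0 ≤ B / r := div_nonneg hB0 hr0.le
    have hMb : ∀ τ ∈ Ioo (4 * t) t, ∀ y, ‖v τ y‖ ≤ B / r := by
      intro τ hτ y
      have hτT : τ < T := hτ.2.trans ht
      refine (hptw τ hτT y).trans ?_
      exact div_le_div_of_nonneg_left hB0 hr0 (Real.sqrt_le_sqrt (by linarith [hτ.2]))
    have hduh := hDuh one_pos (s := 4 * t) (t := t) h4t hM0 hMb hMb x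
    have hone : (1 : ℝ) ^ (-(1 / 2 : ℝ)) = 1 := Real.one_rpow _
    have hsq3 : Real.sqrt (t - 4 * t) = Real.sqrt 3 * r := by
      rw [show t - 4 * t = 3 * (-t) by ring, Real.sqrt_mul (by norm_num)]
    rw [hone, mul_one, hsq3] at hduh
    -- `‖B¹(v,v)(t)(x)‖ ≤ C_os (B/r)² · 2√3 r = K₀ B² / r`
    have hduh' : ‖oseenDuhamel 1 (4 * t) v v t x‖ ≤ K₀ * B ^ 2 / r := by
      refine hduh.trans (le_of_eq ?_)
      rw [hK₀]
      field_simp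
    -- assemble
    have hsum : ‖v t x‖ ≤ B / (2 * r) + K₀ * B ^ 2 / r := by
      rw [hm]
      exact (norm_sub_le _ _).trans (add_le_add hheat hduh')
    calc r * ‖v t x‖ ≤ r * (B / (2 * r) + K₀ * B ^ 2 / r) := mul_le_mul_of_nonneg_left hsum hr0.le
      _ = B / 2 + K₀ * B ^ 2 := by field_simp
  -- hence `B ≤ B/2 + K₀B² ≤ B/2 + B/8`, so `B = 0`
  have hBle : B ≤ B / 2 + K₀ * B ^ 2 :=
    csSup_le hSn (by rintro r ⟨t, ht, x, rfl⟩; exact hkey t ht x)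
  have hB2 : K₀ * B ^ 2 ≤ B / 8 := by
    calc K₀ * B ^ 2 = (K₀ * B) * B := by ring
      _ ≤ (K₀ * ε₀) * B := mul_le_mul_of_nonneg_right (mul_le_mul_of_nonneg_left hBε hK₀0) hB0
      _ ≤ (1 / 8) * B := mul_le_mul_of_nonneg_right hKε hB0
      _ = B / 8 := by ring
  have hBz : B = 0 := le_antisymm (by linarith) hB0
  intro t ht x
  have h := hqB t ht x
  rw [hBz] at h
  have hs : 0 < Real.sqrt (-t) := Real.sqrt_pos.2 (by linarith)
  have hn : ‖v t x‖ ≤ 0 := by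
    by_contra hne
    push Not at hne
    have : 0 < Real.sqrt (-t) * ‖v t x‖ := mul_pos hs hne
    linarith
  exact norm_le_zero_iff.1 hn

/-! ### 4. analyticity: vanishing on a tail propagates to the whole slab -/

/-- **Vanishing on a backward tail propagates to the whole slab** (joint real-analyticity of Oseen-ancient fields,
tree `analyticOnNhd_uncurry`, and the identity theorem on the convex slab `(−∞,0) × ℝ³`). -/
theorem eq_zero_of_eq_zero_tail (hcont : ContinuousOn (uncurry v) (Iio (0 : ℝ) ×ˢ univ))
    (hbdd : ∀ δ : ℝ, 0 < δ → ∃ B : ℝ, ∀ t < -δ, ∀ y : EuclideanSpace ℝ (Fin 3), ‖v t y‖ ≤ B)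
    (hmild : ∀ s t : ℝ, s < t → t < 0 → ∀ x,
      v t x = UnboundedOperators.heatExtension (v s) (t - s) x - oseenDuhamel 1 s v v t x)
    {T : ℝ} (hT : T ≤ 0) (hzero : ∀ t < T, ∀ x, v t x = 0) : ∀ t < 0, ∀ x, v t x = 0 := by
  have han := analyticOnNhd_uncurry hcont hbdd hmild
  have hpre : IsPreconnected (Iio (0 : ℝ) ×ˢ (univ : Set (EuclideanSpace ℝ (Fin 3)))) :=
    ((convex_Iio 0).prod convex_univ).isPreconnected
  have hz₀ : ((T - 1, 0) : ℝ × EuclideanSpace ℝ (Fin 3)) ∈ Iio (0 : ℝ) ×ˢ (univ : Set (EuclideanSpace ℝ (Fin 3))) :=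
    mem_prod.2 ⟨by simp only [mem_Iio]; linarith, mem_univ _⟩
  -- `uncurry v` vanishes on the open set `(−∞, T) × ℝ³`, a neighbourhood of `(T − 1, 0)`
  have hev : uncurry v =ᶠ[𝓝 ((T - 1, 0) : ℝ × EuclideanSpace ℝ (Fin 3))] 0 := by
    have hopen : IsOpen (Iio T ×ˢ (univ : Set (EuclideanSpace ℝ (Fin 3)))) := isOpen_Iio.prod isOpen_univ
    have hmem : ((T - 1, 0) : ℝ × EuclideanSpace ℝ (Fin 3)) ∈ Iio T ×ˢ (univ : Set (EuclideanSpace ℝ (Fin 3))) :=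
      mem_prod.2 ⟨by simp only [mem_Iio]; linarith, mem_univ _⟩
    filter_upwards [hopen.mem_nhds hmem] with z hz
    obtain ⟨hz1, -⟩ := mem_prod.1 hz
    exact hzero z.1 hz1 z.2
  have heq := han.eqOn_zero_of_preconnected_of_eventuallyEq_zero hpre hz₀ hev
  intro t ht x
  have hmem : ((t, x) : ℝ × EuclideanSpace ℝ (Fin 3)) ∈ Iio (0 : ℝ) ×ˢ (univ : Set (EuclideanSpace ℝ (Fin 3))) :=
    mem_prod.2 ⟨mem_Iio.2 ht, mem_univ x⟩
  have h := heq hmem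
  simpa using h

/-! ### the engine -/

/-- **A profile of the class whose scale-invariant size tends to zero backward in time is trivial**
(backward ε-regularity on a tail + analyticity). -/
theorem eq_zero_of_tendsto_zero (hrate : HasTypeITimeDecay C v)
    (hcont : ContinuousOn (uncurry v) (Iio (0 : ℝ) ×ˢ univ))
    (hmild : ∀ s t : ℝ, s < t → t < 0 → ∀ x,
      v t x = UnboundedOperators.heatExtension (v s) (t - s) x - oseenDuhamel 1 s v v t x)
    (hsmall : ∀ ε : ℝ, 0 < ε → ∃ T : ℝ, T < 0 ∧ ∀ t < T, ∀ x, Real.sqrt (-t) * ‖v t x‖ ≤ ε) :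
    ∀ t < 0, ∀ x, v t x = 0 := by
  obtain ⟨ε₀, hε₀, H⟩ := exists_eps_eq_zero_tail
  obtain ⟨T, hT, hTε⟩ := hsmall ε₀ hε₀
  exact eq_zero_of_eq_zero_tail hcont (bdd_of_hasTypeITimeDecay hrate) hmild hT.le (H hT.le hmild hTε)

end Summit.NavierStokesRegularity.NavierStokesRegularity.Theorems.PoloidalWindowDoorPoloidalWindowRigidityZoomOut

end
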